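import Literature.Analysis.Complex.RungeUnits
import Summits.QuantumFields.YangMills.Theorems.BalabanUVNodesN21ResponseRungNumeralAtThm1Letters

/-!
# N21 (NE7c) · THE EXPONENTIAL CHART of one block's integration variables is entire and Lipschitz in the configuration
# — the chart letter `ℓ = c_B` of the response road made explicit (W-SEAT START-LIST v3 §n21 item 3, rung 4)

Width seat `pub-ymgap-dag-n21-w3` (g0), node N21 = NE7c (NOT PRINTED in [Bałaban 1983–89], NOT proved), lane K3⁷
`SpineGivenEndpointR13SepCoPH` (stmt-QuantumFields-20544, `--kind proof --supports … --as helper`).  Consumes BY NAME this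
seat's `…N21ResponseRungNumeralAtThm1Letters` (§0 `responseLetters_of_chart`) and `Literature.Analysis.Complex.RungeUnits`
(`norm_exp_sub_exp_le`: `‖exp x − exp y‖ ≤ ‖x − y‖·e^{max(‖x‖,‖y‖)}` in a Banach algebra); Mathlib `NormedSpace.exp_analytic`.

WHY.  Files 1–4 of this seat reduce part 34's `hRT` for the actually tested variable to [B11] Theorem-1-type letters
PLUS one located conversion constant `c_B` = the Lipschitz constant `ℓ` of the CHART `χ` of one block's (complexified)
integration variables into the configuration space (file 4 (L2) ∕ §0).  In print the integration variables of a block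
enter the configurations through EXPONENTIAL charts — [RG1] = [B12] = CMP 109 (1987) 249, (1.12)–(1.13) p. 262:
«`U^u = exp iξA`», «`U′ = exp iξA′`, `A′` has values in the algebra `𝔤ᶜ`»; [B14] = CMP 119 (1988) 243, (2.21) p. 258: the
fluctuation variables `A_j` — i.e. `χ(w) = (b ↦ exp(Σ_a w_a·X_a(b))·V₀(b))` for fixed algebra-valued bond functions
`X_a` (basis directions) and a base configuration `V₀`.  THIS FILE proves the two chart letters file 4's §0 displays:
`χ` is complex differentiable everywhere (entire) and `ℓ`-Lipschitz about any point on any `r`-ball with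
`ℓ = Ξ·e^{(‖x‖ + r)Ξ}·v` (`Ξ ≥ Σ_a ‖X_a(b)‖` for every bond `b`, `v ≥ ‖V₀(b)‖`), in the sup norm over bonds — so on
the response road `c_B` is no longer a located letter but a formula in the chart data; the remaining located input is
the analyticity-with-sup-bound of the plaquette reading of the minimiser on the complex regular space (NODE O).

WHAT IS PROVED ([textbook]; 0 def, 0 sorry; `𝔄` any complete normed `ℂ`-algebra with `‖1‖ = 1`, e.g. `N × N` matrices
with an operator norm; bonds `B` and block coordinates `κ` finite types; the chart is written as the explicit lambda
`fun w b => exp (∑ a, w a • X a b) * V₀ b`, no definition is introduced).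
* §1 `norm_blockExponent_le`, `norm_blockExponent_sub_le`: `‖Σ_a w_a•X_a(b)‖ ≤ ‖w‖·Ξ`, `‖Σ_a w_a•X_a(b) − Σ_a x_a•X_a(b)‖ ≤ ‖w − x‖·Ξ`.
* §2 `differentiable_blockExpChart`: the chart is complex differentiable on all of `κ → ℂ`.
* §3 ★ `blockExpChart_lipschitz`: `‖χ w − χ x‖ ≤ (Ξ·e^{(‖x‖+r)Ξ}·v)·‖w − x‖` for `w ∈ ball x r`.
* §4 ★★ `responseLetters_of_blockExpChart`: with `Ψ` (the plaquette reading of the minimiser as a function of the block's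
  configuration) complex differentiable on an open `D ⊇ closedBall (χ x) (ℓr)` and `‖Ψ‖ ≤ S` on `D`, the response
  `Φ = Ψ ∘ χ` is differentiable on `ball x r` and maps it into `closedBall (Φ x) (2S)` — file 2's letters `hd`, `hB`
  (`B = 2S`) at the point `x` (file 4 §0 BY NAME).
* §5 A2/A6 `blockExpChart_letters_inhabited`: `𝔄 = ℂ`, one bond, one coordinate, `X = 1`, `V₀ = 1`: the chart is `w ↦ e^{w}`,
  NOT affine, and §3 gives `‖e^{w} − 1‖ ≤ e·‖w‖` on the unit ball about `0`.

HONEST FRAMING.  [textbook] Banach-algebra calculus; the identification of `χ` with print's charts (1.12)–(1.13) ∕ (2.21)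
is a located DICTIONARY, NOT asserted and NOT typed at NODE 00's objects (`Node00.UbgOfRecord`); nothing of Bałaban's
asserted; NE7c NOT PRINTED ∕ NOT proved; N21 NOT discharged; counts unmoved (typed 28∕28 · discharged 5∕27);
count-neutral; one finite 𝕋⁴ at fixed ε — YM mass gap (Clay) is NOT proved by any of this: R4 closes the conditional
finite-𝕋⁴ rung `BalabanLadder.UV` only; nothing continuum ∕ ℝ⁴ ∕ OS ∕ mass gap ∕ Clay.
-/

noncomputable section

open NormedSpace Metric Set

namespace Summit.QuantumFields.YangMills.Theorems.N21ExponentialChartResponse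

open Summit.QuantumFields.YangMills.Theorems.N21ResponseRungNumeralAtThm1Letters (responseLetters_of_chart)

variable {𝔄 : Type*} [NormedRing 𝔄] [NormedAlgebra ℂ 𝔄] [CompleteSpace 𝔄] [NormOneClass 𝔄]
  {κ B : Type*} [Fintype κ] [Fintype B]

/-! ## §1  The linear part of the chart: norm bounds -/

omit [CompleteSpace 𝔄] [NormOneClass 𝔄] [Fintype B] in
/-- `‖Σ_a w_a • X_a(b)‖ ≤ ‖w‖ · Ξ` whenever `Σ_a ‖X_a(b)‖ ≤ Ξ`. [textbook] -/
theorem norm_blockExponent_le (X : κ → B → 𝔄) {Ξ : ℝ} (hΞ : ∀ b, ∑ a, ‖X a b‖ ≤ Ξ) (w : κ → ℂ) (b : B) :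
    ‖∑ a, w a • X a b‖ ≤ ‖w‖ * Ξ := by
  calc ‖∑ a, w a • X a b‖ ≤ ∑ a, ‖w a • X a b‖ := norm_sum_le _ _
    _ = ∑ a, ‖w a‖ * ‖X a b‖ := by simp_rw [norm_smul]
    _ ≤ ∑ a, ‖w‖ * ‖X a b‖ := Finset.sum_le_sum fun a _ =>
        mul_le_mul_of_nonneg_right (norm_le_pi_norm w a) (norm_nonneg _)
    _ = ‖w‖ * ∑ a, ‖X a b‖ := by rw [Finset.mul_sum]
    _ ≤ ‖w‖ * Ξ := mul_le_mul_of_nonneg_left (hΞ b) (norm_nonneg _)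

omit [CompleteSpace 𝔄] [NormOneClass 𝔄] [Fintype B] in
/-- `‖Σ_a w_a • X_a(b) − Σ_a x_a • X_a(b)‖ ≤ ‖w − x‖ · Ξ`. [textbook] -/
theorem norm_blockExponent_sub_le (X : κ → B → 𝔄) {Ξ : ℝ} (hΞ : ∀ b, ∑ a, ‖X a b‖ ≤ Ξ) (w x : κ → ℂ) (b : B) :
    ‖∑ a, w a • X a b - ∑ a, x a • X a b‖ ≤ ‖w - x‖ * Ξ := by
  have h : ∑ a, w a • X a b - ∑ a, x a • X a b = ∑ a, (w - x) a • X a b := by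
    rw [← Finset.sum_sub_distrib]
    refine Finset.sum_congr rfl fun a _ => ?_
    rw [Pi.sub_apply, sub_smul]
  rw [h]
  exact norm_blockExponent_le X hΞ (w - x) b

/-! ## §2  The exponential chart is entire -/

omit [NormOneClass 𝔄] [Fintype B] in
/-- **THE EXPONENTIAL CHART IS COMPLEX DIFFERENTIABLE EVERYWHERE** (`NormedSpace.exp` is analytic on a complete normed
algebra; the exponent is linear in `w`; right multiplication by the base configuration). [textbook] -/
theorem differentiable_blockExpChart (X : κ → B → 𝔄) (V₀ : B → 𝔄) :
    Differentiable ℂ (fun w : κ → ℂ => fun b => exp (∑ a, w a • X a b) * V₀ b) := by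
  refine differentiable_pi.2 fun b => ?_
  have hL : Differentiable ℂ fun w : κ → ℂ => ∑ a, w a • X a b := by
    refine Differentiable.fun_sum fun a _ => ?_
    exact (differentiable_apply a).smul_const (X a b)
  have hE : Differentiable ℂ fun w : κ → ℂ => exp (∑ a, w a • X a b) :=
    fun w => (exp_analytic (𝕂 := ℂ) (∑ a, w a • X a b)).differentiableAt.comp w (hL w)
  exact hE.mul_const (V₀ b)

/-! ## §3  The exponential chart is Lipschitz on balls (the letter `ℓ = c_B`) -/

omit [Fintype B] in
/-- one bond: `‖exp(A_w)V − exp(A_x)V‖ ≤ ‖w − x‖·Ξ·e^{(‖x‖+r)Ξ}·v` for `‖w − x‖ < r`. [textbook] -/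
theorem norm_blockExpChart_apply_sub_le (X : κ → B → 𝔄) (V₀ : B → 𝔄) {Ξ v r : ℝ} (hΞ0 : 0 ≤ Ξ)
    (hΞ : ∀ b, ∑ a, ‖X a b‖ ≤ Ξ) (hv : ∀ b, ‖V₀ b‖ ≤ v) (x : κ → ℂ) {w : κ → ℂ} (hw : w ∈ ball x r) (b : B) :
    ‖exp (∑ a, w a • X a b) * V₀ b - exp (∑ a, x a • X a b) * V₀ b‖
      ≤ Ξ * Real.exp ((‖x‖ + r) * Ξ) * v * ‖w - x‖ := by
  have hwx : ‖w - x‖ < r := by rwa [mem_ball, dist_eq_norm] at hw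
  have hw' : ‖w‖ ≤ ‖x‖ + r := by
    calc ‖w‖ = ‖x + (w - x)‖ := by rw [add_sub_cancel]
      _ ≤ ‖x‖ + ‖w - x‖ := norm_add_le _ _
      _ ≤ ‖x‖ + r := by linarith
  have hv0 : 0 ≤ v := (norm_nonneg _).trans (hv b)
  have hAw : ‖∑ a, w a • X a b‖ ≤ (‖x‖ + r) * Ξ :=
    (norm_blockExponent_le X hΞ w b).trans (mul_le_mul_of_nonneg_right hw' hΞ0)
  have hAx : ‖∑ a, x a • X a b‖ ≤ (‖x‖ + r) * Ξ :=
    (norm_blockExponent_le X hΞ x b).trans (mul_le_mul_of_nonneg_right (by linarith [hwx, norm_nonneg (w - x)]) hΞ0)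
  have hmax : max ‖∑ a, w a • X a b‖ ‖∑ a, x a • X a b‖ ≤ (‖x‖ + r) * Ξ := max_le hAw hAx
  have hexp := Literature.Analysis.Complex.norm_exp_sub_exp_le (∑ a, w a • X a b) (∑ a, x a • X a b)
  rw [← sub_mul]
  calc ‖(exp (∑ a, w a • X a b) - exp (∑ a, x a • X a b)) * V₀ b‖
      ≤ ‖exp (∑ a, w a • X a b) - exp (∑ a, x a • X a b)‖ * ‖V₀ b‖ := norm_mul_le _ _
    _ ≤ (‖∑ a, w a • X a b - ∑ a, x a • X a b‖ * Real.exp (max ‖∑ a, w a • X a b‖ ‖∑ a, x a • X a b‖)) * v :=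
        mul_le_mul hexp (hv b) (norm_nonneg _) (by positivity)
    _ ≤ (‖w - x‖ * Ξ * Real.exp ((‖x‖ + r) * Ξ)) * v := by
        refine mul_le_mul_of_nonneg_right ?_ hv0
        exact mul_le_mul (norm_blockExponent_sub_le X hΞ w x b) (Real.exp_le_exp.2 hmax) (by positivity)
          (by positivity)
    _ = Ξ * Real.exp ((‖x‖ + r) * Ξ) * v * ‖w - x‖ := by ring

/-- ★ **THE EXPONENTIAL CHART IS `ℓ`-LIPSCHITZ ABOUT ANY POINT ON ANY BALL**, `ℓ = Ξ·e^{(‖x‖+r)Ξ}·v`, in the sup norm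
over bonds: `‖χ w − χ x‖ ≤ ℓ·‖w − x‖` for `w ∈ ball x r` — the hypothesis `hχℓ` of file 4's `responseLetters_of_chart`
(the located letter `c_B` made a formula in the chart data `Ξ, v`). [textbook] -/
theorem blockExpChart_lipschitz (X : κ → B → 𝔄) (V₀ : B → 𝔄) {Ξ v r : ℝ} (hΞ0 : 0 ≤ Ξ)
    (hΞ : ∀ b, ∑ a, ‖X a b‖ ≤ Ξ) (hv0 : 0 ≤ v) (hv : ∀ b, ‖V₀ b‖ ≤ v) (x : κ → ℂ) :
    ∀ w ∈ ball x r, ‖(fun b => exp (∑ a, w a • X a b) * V₀ b) - (fun b => exp (∑ a, x a • X a b) * V₀ b)‖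
      ≤ Ξ * Real.exp ((‖x‖ + r) * Ξ) * v * ‖w - x‖ := by
  intro w hw
  refine (pi_norm_le_iff_of_nonneg (by positivity)).2 fun b => ?_
  exact norm_blockExpChart_apply_sub_le X V₀ hΞ0 hΞ hv x hw b

/-! ## §4  File 2's analytic letters for a response read through the exponential chart -/

/-- ★★ **RESPONSE LETTERS THROUGH THE EXPONENTIAL CHART** (file 4 §0 `responseLetters_of_chart` with both chart
hypotheses DISCHARGED by §2–§3): if the plaquette reading `Ψ` of the minimiser, as a function of the block's
configuration `B → 𝔄`, is complex differentiable on an open `D ⊇ closedBall (χ x) (ℓr)` (`ℓ = Ξ·e^{(‖x‖+r)Ξ}·v`) with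
`‖Ψ‖ ≤ S` there — the [B11] Theorem 1 ∕ [RG1] Lemma 4 SHAPE, displayed — then the response `Φ = Ψ ∘ χ` is complex
differentiable on `ball x r` and maps it into `closedBall (Φ x) (2S)`: the letters `hd`, `hB` (`B = 2S`) of
`N21AnalyticResponseRemainder` at the (complexified) block point `x`. [textbook] -/
theorem responseLetters_of_blockExpChart {E : Type*} [NormedAddCommGroup E] [NormedSpace ℂ E]
    (X : κ → B → 𝔄) (V₀ : B → 𝔄) {Ξ v r S : ℝ} (hΞ0 : 0 ≤ Ξ) (hΞ : ∀ b, ∑ a, ‖X a b‖ ≤ Ξ) (hv0 : 0 ≤ v)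
    (hv : ∀ b, ‖V₀ b‖ ≤ v) (hr : 0 < r) (x : κ → ℂ) (Ψ : (B → 𝔄) → E) {D : Set (B → 𝔄)}
    (hD : closedBall (fun b => exp (∑ a, x a • X a b) * V₀ b) (Ξ * Real.exp ((‖x‖ + r) * Ξ) * v * r) ⊆ D)
    (hΨd : DifferentiableOn ℂ Ψ D) (hΨS : ∀ u ∈ D, ‖Ψ u‖ ≤ S) :
    DifferentiableOn ℂ (Ψ ∘ fun w : κ → ℂ => fun b => exp (∑ a, w a • X a b) * V₀ b) (ball x r) ∧
      MapsTo (Ψ ∘ fun w : κ → ℂ => fun b => exp (∑ a, w a • X a b) * V₀ b) (ball x r)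
        (closedBall ((Ψ ∘ fun w : κ → ℂ => fun b => exp (∑ a, w a • X a b) * V₀ b) x) (2 * S)) :=
  responseLetters_of_chart (fun w : κ → ℂ => fun b => exp (∑ a, w a • X a b) * V₀ b) Ψ hr (by positivity)
    (differentiable_blockExpChart X V₀).differentiableOn (blockExpChart_lipschitz X V₀ hΞ0 hΞ hv0 hv x) hD hΨd hΨS

/-! ## §5  A2/A6: the chart letters are inhabited (`𝔄 = ℂ`, one bond, one coordinate) -/

/-- **A2/A6 — THE CHART LETTERS ARE INHABITED AND THE CHART IS NOT AFFINE**: `𝔄 = ℂ`, `κ = B = Unit`, `X = 1`, `V₀ = 1`,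
so `χ(w)(b) = e^{w ()}`; with `Ξ = v = 1`, `x = 0`, `r = 1`, §3 reads `‖χ w − χ 0‖ ≤ e·‖w‖` on the unit ball, and
`w ↦ e^{w}` is not affine. [textbook] -/
theorem blockExpChart_letters_inhabited :
    (∀ w ∈ ball (0 : Unit → ℂ) 1,
      ‖(fun _ : Unit => exp (∑ a : Unit, w a • (1 : ℂ)) * (1 : ℂ)) -
          (fun _ : Unit => exp (∑ a : Unit, (0 : Unit → ℂ) a • (1 : ℂ)) * (1 : ℂ))‖
        ≤ 1 * Real.exp ((‖(0 : Unit → ℂ)‖ + 1) * 1) * 1 * ‖w - 0‖) ∧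
    ¬ ∃ a b : ℂ, ∀ z : ℂ, exp z = a * z + b := by
  refine ⟨blockExpChart_lipschitz (κ := Unit) (B := Unit) (fun _ _ => (1 : ℂ)) (fun _ => 1) zero_le_one
    (fun _ => by simp) zero_le_one (fun _ => by simp) 0, ?_⟩
  rintro ⟨a, b, h⟩
  have h0 := h 0
  have h1 := h 1
  have hm1 := h (-1)
  rw [← Complex.exp_eq_exp_ℂ] at h0 h1 hm1
  rw [Complex.exp_zero] at h0
  have hsum : Complex.exp 1 + Complex.exp (-1) = 2 := by linear_combination h1 + hm1 - 2 * h0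
  have e1 : (Complex.exp 1).re = Real.exp 1 := by
    rw [show (1 : ℂ) = ((1 : ℝ) : ℂ) by simp, Complex.exp_ofReal_re]
  have e2 : (Complex.exp (-1)).re = Real.exp (-1) := by
    rw [show (-1 : ℂ) = ((-1 : ℝ) : ℂ) by simp, Complex.exp_ofReal_re]
  have hre : Real.exp 1 + Real.exp (-1) = 2 := by
    have := congrArg Complex.re hsum
    rw [Complex.add_re, e1, e2] at this
    simpa using this
  linarith [Real.add_one_le_exp (1 : ℝ), Real.exp_pos (-1)]

end Summit.QuantumFields.YangMills.Theorems.N21ExponentialChartResponse
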